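import Literature.NumberTheory.EllipticCurves.KubertTateNineValuationsThree
import Literature.NumberTheory.EllipticCurves.RootNumberTableThreeKodairaProofs
import Literature.NumberTheory.EllipticCurves.RootNumberTableThreeKodairaRowsProofs
import Literature.NumberTheory.EllipticCurves.RootNumberTableThreeCondExpProofs
import Literature.NumberTheory.EllipticCurves.RootNumberTableThreeCondExpRowsProofs
import Literature.NumberTheory.EllipticCurves.RootNumberTableThreeLocalReadingsProofs
import HarnessLib

/-!
# The local data at `3` of Kubert's `ℤ/9` family `E₉(f)` (the fibres of `X₁(9)` over `ℚ₃`): Kodaira type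
# `IV` with `f₃ = 3` on the additive fibre `3 ∣ num(f) + den(f)`, multiplicative `I₉ₑ` elsewhere

Topic `NumberTheory/EllipticCurves`; continues `KubertTateNineInvariants` / `KubertTateNineValuationsThree` (the invariants,
their `3`-adic valuations) and uses the tree's PROVED bridges between Tate's algorithm at `3` and Rizzo's Table II
(`WeierstrassCurve.kodairaSymbolAt_eq_tableKodairaSymbolThree`, row T-PAP3-KOD;
`WeierstrassCurve.conductorExponent_eq_tableConductorExponentThree_holds`, the `v(N)` column; the row
lemmas `Rizzo.kodaira_row_2_3_5`, `Rizzo.condExp_row_2_3_5`, `Rizzo.kodaira_row_0_0_pos`,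
`Rizzo.condExp_row_0_0_pos` and the reading `Rizzo.ofInvariants_eq_tableII_of_val3`). THEOREMS ONLY (no
definition, no named fact, no `sorry`).

THE PRINTED STATEMENT (A. J. Barrios, M. Roy, Pacific J. Math. 318 (2022), Thm. 3.8, table row `T = C₉`, and
§3.5 Case 3, arXiv:2104.10337 pp. 18–20): "The family of elliptic curves `E_{C₉}` has additive reduction at a
prime `p` if and only if `p = 3` with `v₃(a + b) ≥ 1`. … we conclude that `E_{C₉}` has Kodaira–Néron type
`IV` at `3` with `f₃ = 3`. Lastly `c₃ = 3`"; table: `C₉ | 3 | IV | v₃(a + b) ≥ 1 | f_p = 3 | c_p = 3`. Their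
`E_{C₉}(a, b)` (`a, b` coprime) is Kubert's `E₉(f)`, `f = b/a`, rescaled by `u = a` (their Table 2:
`a₁ = a³ + ab² - b³`), so "`v₃(a + b) ≥ 1`" is "`3 ∣ num(f) + den(f)`" below.

## What is here (for `E/ℚ` elliptic given by ANY equation `W` with `C • W = E₉(f)`, and `v ∣ 3`)

* (recalled from `KubertTateNineValuationsThree`) on the fibre `3 ∣ num + den`,
  `(v₃ c₄, v₃ c₆, v₃ Δ) = (2, 3, 5)` (`padicValRat_kubertTate_nine_c₄_of_three_dvd`, `…c₆…`, `…Δ…`); off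
  it, `(-12e', -18e', 9(v₃ num + v₃(num - den)) - 27e')`, `e' = v₃(den)` (`…_of_not_three_dvd`); hence
  `c₄(E₉ f) ≠ 0`, `c₆(E₉ f) ≠ 0` for every `f ∈ ℚ`.
* §5 **`kodairaSymbolAt_eq_IV_of_smul_eq_kubertTate_nine`**: `3 ∣ num(f) + den(f)` ⟹ the Kodaira symbol
  of `E` at `v` is `IV`, and **`conductorExponent_eq_three_of_smul_eq_kubertTate_nine`**: `f_v(E) = 3`
  (reduced triple `(2, 3, 5)` = row `(2,3,5)` of Table II, for any equation: the local shift absorbs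
  `v₃(u)`; `ofInvariants_eq_row_2_3_5_of_smul_eq_kubertTate_nine`);
  **`kodairaSymbolAt_eq_I_of_smul_eq_kubertTate_nine`**: `3 ∤ num(f) + den(f)` ⟹ type `Iₙ`,
  `n = 9(v₃ num + v₃(num - den) + v₃ den) ≥ 9` (multiplicative), and `f_v(E) = 1`
  (`conductorExponent_eq_one_of_smul_eq_kubertTate_nine`). So a curve over `ℚ` with a rational point of
  order `9` (`exists_addOrderOf_eq_nine_iff_exists_kubertTate_nine`) is never of good reduction at `3`,
  is additive at `3` iff `3 ∣ num(f) + den(f)` in Kubert's chart, and then is of type `IV` exactly with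
  `v₃(N) = 3` (Cremona census below `5·10⁵`: classes 54b, 1890r, 122094bl, `N = 27·2, 27·70, 27·4522`).

Cross-check outside Lean (not an input): PARI/GP `elllocalred(E₉(m/n), 3)` on all coprime `(m, n)`,
`|m|, n ≤ 120` (17 541 curves): additive iff `3 ∣ m + n` (4 369 curves), all `[f₃, Kod, c₃] = [3, IV, 3]`
with `N = 27·(squarefree prime to 3)`; the other 13 172 all `I₉ₑ` with `f₃ = 1` (compute job j267526).

What is NOT here: the Tamagawa number `c₃ = 3` (the tree reads it off the rational `9`-torsion at an
additive prime: `Summits/…/KatoDescentPotSupersingularWildUpperReducibleNineTorsionLocal`); the local root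
number `W₃ = +1` of row `(2,3,5)` (`Δ' ≡ c₆' (mod 3)` holds on the fibre but is not transcribed); `p ≠ 3`.

References: [BarriosRoy2022LocalData] Thm. 3.8 and §3.5 Case 3; [Rizzo2003] Table II (p. 4), rows
`(2,3,5)`, `(0,0,≥1)`; [Papadopoulos1993] Table III (`p = 3`); [Silverman1994] IV.9.4 (Tate's algorithm);
[Kubert1976] Table 3 (`N = 9`).
-/

noncomputable section

open scoped Classical

namespace WeierstrassCurve

/-! ### §5 Tate's algorithm at `3` on the family, through the tree's proved Table II bridges -/

section LocalData

open Literature.NumberTheory.EllipticCurves Literature.NumberTheory.EllipticCurves.Rizzo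
open Literature.NumberTheory.DiophantineGeometry (KodairaSymbol)
open IsDedekindDomain

variable {f : ℚ} {W : WeierstrassCurve ℚ} {C : VariableChange ℚ}

/-- `W = C⁻¹ • E₉(f)`: `c₄(W) = u⁴·c₄(E₉(f))`. [folklore] -/
private theorem c₄_eq_of_smul_eq {V : WeierstrassCurve ℚ} (hC : C • W = V) :
    W.c₄ = (C.u : ℚ) ^ 4 * V.c₄ := by
  rw [← hC, variableChange_c₄, ← mul_assoc, ← mul_pow, Units.mul_inv, one_pow, one_mul]

/-- `c₆(W) = u⁶·c₆(E₉(f))`. [folklore] -/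
private theorem c₆_eq_of_smul_eq {V : WeierstrassCurve ℚ} (hC : C • W = V) :
    W.c₆ = (C.u : ℚ) ^ 6 * V.c₆ := by
  rw [← hC, variableChange_c₆, ← mul_assoc, ← mul_pow, Units.mul_inv, one_pow, one_mul]

/-- `Δ(W) = u¹²·Δ(E₉(f))`. [folklore] -/
private theorem Δ_eq_of_smul_eq {V : WeierstrassCurve ℚ} (hC : C • W = V) :
    W.Δ = (C.u : ℚ) ^ 12 * V.Δ := by
  rw [← hC, variableChange_Δ, ← mul_assoc, ← mul_pow, Units.mul_inv, one_pow, one_mul]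

/-- `v₃(uᵏ·x) = k·v₃(u) + v₃(x)` for a unit `u` and `x ≠ 0`. [folklore] -/
private theorem padicValRat_unit_pow_mul {u : ℚˣ} {x : ℚ} (hx : x ≠ 0) (k : ℕ) :
    padicValRat 3 ((u : ℚ) ^ k * x) = k * padicValRat 3 (u : ℚ) + padicValRat 3 x := by
  haveI : Fact (Nat.Prime 3) := ⟨Nat.prime_three⟩
  rw [padicValRat.mul (pow_ne_zero _ u.ne_zero) hx, padicValRat.pow]

/-- **Table II on the additive fibre.**  For `E/ℚ` elliptic with `C • W = E₉(f)`, `3 ∣ num(f) + den(f)`: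
the rational invariants of `W` have `3`-adic valuations `(2, 3, 5) + (4, 6, 12)·v₃(u)`, so Rizzo's
reading `ofInvariants` lands on row `(2, 3, 5)` of Table II (local shift `0`).
[cite: Rizzo2003, §1.1–1.2 (pp. 3–4) and Table II (p. 4), row (2,3,5)]
[cite: BarriosRoy2022LocalData, Thm. 3.8 (table, T = C₉, p = 3)] -/
theorem ofInvariants_eq_row_2_3_5_of_smul_eq_kubertTate_nine [W.IsElliptic]
    (hC : C • W = kubertTate (f ^ 2 * (f - 1) * (f ^ 2 - f + 1)) (f ^ 2 * (f - 1)))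
    (h3 : (3 : ℤ) ∣ f.num + f.den) :
    ofInvariants W.c₄ W.c₆ W.Δ = tableII ((2 : ℤ) : WithTop ℤ) ((3 : ℤ) : WithTop ℤ) 5
      (res9 W.c₄) (res9 W.c₆) (res9 W.Δ) := by
  haveI : Fact (Nat.Prime 3) := ⟨Nat.prime_three⟩
  set U : ℤ := padicValRat 3 (C.u : ℚ) with hU
  have hne4 := kubertTate_nine_c₄_ne_zero f
  have hne6 := kubertTate_nine_c₆_ne_zero f
  have hneΔ : (kubertTate (f ^ 2 * (f - 1) * (f ^ 2 - f + 1)) (f ^ 2 * (f - 1))).Δ ≠ 0 := by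
    rw [← hC, variableChange_Δ]
    exact mul_ne_zero (pow_ne_zero _ (C.u⁻¹).ne_zero) W.isUnit_Δ.ne_zero
  have hW4ne : W.c₄ ≠ 0 := by
    rw [c₄_eq_of_smul_eq hC]; exact mul_ne_zero (pow_ne_zero _ C.u.ne_zero) hne4
  have hW6ne : W.c₆ ≠ 0 := by
    rw [c₆_eq_of_smul_eq hC]; exact mul_ne_zero (pow_ne_zero _ C.u.ne_zero) hne6
  have hW4 : padicValRat 3 W.c₄ = 2 - 4 * (-U) := by
    rw [c₄_eq_of_smul_eq hC, padicValRat_unit_pow_mul hne4,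
      padicValRat_kubertTate_nine_c₄_of_three_dvd f h3]
    push_cast; ring
  have hW6 : padicValRat 3 W.c₆ = 3 - 6 * (-U) := by
    rw [c₆_eq_of_smul_eq hC, padicValRat_unit_pow_mul hne6,
      padicValRat_kubertTate_nine_c₆_of_three_dvd f h3]
    push_cast; ring
  have hWΔ : padicValRat 3 W.Δ = 5 - 12 * (-U) := by
    rw [Δ_eq_of_smul_eq hC, padicValRat_unit_pow_mul hneΔ,
      padicValRat_kubertTate_nine_Δ_of_three_dvd f h3]
    push_cast; ring
  have h4 : val3 W.c₄ = ((2 : ℤ) : WithTop ℤ).map fun m => m - 4 * (-U) := by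
    simp only [val3, hW4ne, if_false, hW4, WithTop.map_coe]
  have h6 : val3 W.c₆ = ((3 : ℤ) : WithTop ℤ).map fun m => m - 6 * (-U) := by
    simp only [val3, hW6ne, if_false, hW6, WithTop.map_coe]
  have hs : KellockDokchitser.shift 5 ((3 : ℤ) : WithTop ℤ) ((2 : ℤ) : WithTop ℤ) = 0 :=
    shift_eq_zero (by norm_num) (WithTop.coe_nonneg.mpr (by norm_num))
      (WithTop.coe_nonneg.mpr (by norm_num)) (Or.inl (by norm_num))
  rw [ofInvariants_eq_tableII_of_val3 h4 h6 hWΔ, hs]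
  simp

/-- **The additive fibre of `X₁(9)` at `3` is of Kodaira type `IV`.**  Let `E/ℚ` be an elliptic curve
given by any Weierstrass equation `W`, `ℚ`-isomorphic (`C • W = E₉(f)`) to a member of Kubert's `ℤ/9`
family with `3 ∣ num(f) + den(f)` (i.e. `f ≡ -1` in `ℤ₍₃₎`; Barrios–Roy: `E_{C₉}(a, b)` with
`3 ∣ a + b`).  Then the Kodaira symbol of `E` at the place `v ∣ 3` (Tate's algorithm,
`kodairaSymbolAt`) is `IV`: the reduced triple `(v₃(c₄), v₃(c₆), v₃(Δ)) = (2, 3, 5)` is row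
`(2, 3, 5)` of Papadopoulos' / Rizzo's Table II (`kodairaSymbolAt_eq_tableKodairaSymbolThree`).
[cite: BarriosRoy2022LocalData, Thm. 3.8 (table, T = C₉: additive at 3 iff 3 ∣ a + b, then type IV, f₃ = 3, c₃ = 3)]
[cite: Rizzo2003, Table II (p. 4), row (2,3,5)] [cite: Papadopoulos1993, Table III (p = 3)] -/
theorem kodairaSymbolAt_eq_IV_of_smul_eq_kubertTate_nine [W.IsElliptic]
    (hC : C • W = kubertTate (f ^ 2 * (f - 1) * (f ^ 2 - f + 1)) (f ^ 2 * (f - 1)))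
    (h3 : (3 : ℤ) ∣ f.num + f.den) {v : HeightOneSpectrum ℤ} (hv : ringChar (ℤ ⧸ v.asIdeal) = 3) :
    W.kodairaSymbolAt v = KodairaSymbol.IV := by
  rw [kodairaSymbolAt_eq_tableKodairaSymbolThree W hv, tableKodairaSymbolThree_def]
  unfold kodairaOfInvariants
  rw [ofInvariants_eq_row_2_3_5_of_smul_eq_kubertTate_nine hC h3]
  exact kodaira_row_2_3_5 _ _ _

/-- **… with conductor exponent `f₃ = 3`** (row `(2, 3, 5)` of Table II, column `v(N)`, through the
discharged named fact `conductorExponent_eq_tableConductorExponentThree`).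
[cite: BarriosRoy2022LocalData, Thm. 3.8 (table, T = C₉: f₃ = 3)] [cite: Rizzo2003, Table II (p. 4), row (2,3,5)] -/
theorem conductorExponent_eq_three_of_smul_eq_kubertTate_nine [W.IsElliptic]
    (hC : C • W = kubertTate (f ^ 2 * (f - 1) * (f ^ 2 - f + 1)) (f ^ 2 * (f - 1)))
    (h3 : (3 : ℤ) ∣ f.num + f.den) {v : HeightOneSpectrum ℤ} (hv : ringChar (ℤ ⧸ v.asIdeal) = 3) :
    W.conductorExponent v = 3 := by
  rw [conductorExponent_eq_tableConductorExponentThree_holds W v hv, tableConductorExponentThree_def]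
  unfold condExpOfInvariants
  rw [ofInvariants_eq_row_2_3_5_of_smul_eq_kubertTate_nine hC h3]
  exact condExp_row_2_3_5 _ _ _

/-- Off the additive fibre the exponent `e = v₃(num f) + v₃(num f - den f) + v₃(den f)` is positive
(`3` divides one of `den`, `num`, `num - den` when `3 ∤ num + den`), for `f ∉ {0, 1}`. [folklore] -/
private theorem one_le_kubertNineExponent_of_not_three_dvd (h : ¬ (3 : ℤ) ∣ f.num + f.den) (hf0 : f ≠ 0)
    (hf1 : f ≠ 1) :
    1 ≤ padicValInt 3 f.num + padicValInt 3 (f.num - f.den) + padicValNat 3 f.den := by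
  haveI : Fact (Nat.Prime 3) := ⟨Nat.prime_three⟩
  have hm0 : f.num ≠ 0 := Rat.num_ne_zero.mpr hf0
  have hmn0 : f.num - f.den ≠ 0 := by
    intro h0
    apply hf1
    have h1 : f.num = f.den := by omega
    rw [← Rat.num_div_den f, h1]
    exact div_self (by exact_mod_cast f.den_ne_zero)
  by_cases hd : 3 ∣ f.den
  · have := one_le_padicValNat_of_dvd f.den_ne_zero hd
    omega
  · have hd' : ¬ (3 : ℤ) ∣ (f.den : ℤ) := fun h' => hd (by exact_mod_cast h')
    by_cases hm : (3 : ℤ) ∣ f.num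
    · have h1 : 1 ≤ padicValInt 3 f.num :=
        ((padicValInt_dvd_iff 1 f.num).mp (by simpa using hm)).resolve_left hm0
      omega
    · have hmn : (3 : ℤ) ∣ f.num - f.den := by
        have hx : f.num % 3 = 1 ∨ f.num % 3 = 2 := by omega
        have hy : (f.den : ℤ) % 3 = 1 ∨ (f.den : ℤ) % 3 = 2 := by omega
        rcases hx with hx | hx <;> rcases hy with hy | hy <;> omega
      have h1 : 1 ≤ padicValInt 3 (f.num - f.den) :=
        ((padicValInt_dvd_iff 1 (f.num - f.den)).mp (by simpa using hmn)).resolve_left hmn0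
      omega

/-- **Table II off the additive fibre.**  For `E/ℚ` elliptic with `C • W = E₉(f)`, `3 ∤ num(f) + den(f)`:
Rizzo's reading lands on row `(0, 0, 9e)`, `e = v₃(num f) + v₃(num f - den f) + v₃(den f) ≥ 1`
(local shift `3·v₃(den f) - v₃(u)`). [cite: Rizzo2003, §1.1–1.2 (pp. 3–4) and Table II (p. 4), row (0,0,≥1)]
[cite: BarriosRoy2022LocalData, Thm. 3.8 (table, T = C₉, p = 3)] -/
theorem ofInvariants_eq_row_0_0_of_smul_eq_kubertTate_nine [W.IsElliptic]
    (hC : C • W = kubertTate (f ^ 2 * (f - 1) * (f ^ 2 - f + 1)) (f ^ 2 * (f - 1)))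
    (h3 : ¬ (3 : ℤ) ∣ f.num + f.den) :
    ofInvariants W.c₄ W.c₆ W.Δ = tableII ((0 : ℤ) : WithTop ℤ) ((0 : ℤ) : WithTop ℤ)
        ((9 * (padicValInt 3 f.num + padicValInt 3 (f.num - f.den) + padicValNat 3 f.den) : ℕ) : ℤ)
        (res9 W.c₄) (res9 W.c₆) (res9 W.Δ) ∧
      1 ≤ padicValInt 3 f.num + padicValInt 3 (f.num - f.den) + padicValNat 3 f.den := by
  haveI : Fact (Nat.Prime 3) := ⟨Nat.prime_three⟩
  set U : ℤ := padicValRat 3 (C.u : ℚ) with hU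
  set E : ℕ := padicValInt 3 f.num + padicValInt 3 (f.num - f.den) + padicValNat 3 f.den with hE
  have hne4 := kubertTate_nine_c₄_ne_zero f
  have hne6 := kubertTate_nine_c₆_ne_zero f
  have hneΔ : (kubertTate (f ^ 2 * (f - 1) * (f ^ 2 - f + 1)) (f ^ 2 * (f - 1))).Δ ≠ 0 := by
    rw [← hC, variableChange_Δ]
    exact mul_ne_zero (pow_ne_zero _ (C.u⁻¹).ne_zero) W.isUnit_Δ.ne_zero
  obtain ⟨hf0, hf1⟩ := kubertTate_nine_ne_zero_and_ne_one_of_Δ_ne_zero f hneΔ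
  have hE1 : 1 ≤ E := one_le_kubertNineExponent_of_not_three_dvd h3 hf0 hf1
  have hW4ne : W.c₄ ≠ 0 := by
    rw [c₄_eq_of_smul_eq hC]; exact mul_ne_zero (pow_ne_zero _ C.u.ne_zero) hne4
  have hW6ne : W.c₆ ≠ 0 := by
    rw [c₆_eq_of_smul_eq hC]; exact mul_ne_zero (pow_ne_zero _ C.u.ne_zero) hne6
  set k : ℤ := 3 * (padicValNat 3 f.den : ℤ) - U with hk
  have hW4 : padicValRat 3 W.c₄ = 0 - 4 * k := by
    rw [c₄_eq_of_smul_eq hC, padicValRat_unit_pow_mul hne4,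
      padicValRat_kubertTate_nine_c₄_of_not_three_dvd f h3, hk]
    push_cast; ring
  have hW6 : padicValRat 3 W.c₆ = 0 - 6 * k := by
    rw [c₆_eq_of_smul_eq hC, padicValRat_unit_pow_mul hne6,
      padicValRat_kubertTate_nine_c₆_of_not_three_dvd f h3, hk]
    push_cast; ring
  have hWΔ : padicValRat 3 W.Δ = ((9 * E : ℕ) : ℤ) - 12 * k := by
    rw [Δ_eq_of_smul_eq hC, padicValRat_unit_pow_mul hneΔ,
      padicValRat_kubertTate_nine_Δ_of_not_three_dvd f h3 hf0 hf1, hk, hE]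
    push_cast; ring
  have h4 : val3 W.c₄ = ((0 : ℤ) : WithTop ℤ).map fun m => m - 4 * k := by
    simp only [val3, hW4ne, if_false, hW4, WithTop.map_coe]
  have h6 : val3 W.c₆ = ((0 : ℤ) : WithTop ℤ).map fun m => m - 6 * k := by
    simp only [val3, hW6ne, if_false, hW6, WithTop.map_coe]
  have hs : KellockDokchitser.shift ((9 * E : ℕ) : ℤ) ((0 : ℤ) : WithTop ℤ) ((0 : ℤ) : WithTop ℤ) = 0 :=
    shift_eq_zero (by positivity) (WithTop.coe_nonneg.mpr le_rfl) (WithTop.coe_nonneg.mpr le_rfl)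
      (Or.inr (Or.inr ⟨0, rfl, by norm_num⟩))
  refine ⟨?_, hE1⟩
  rw [ofInvariants_eq_tableII_of_val3 h4 h6 hWΔ, hs]
  simp

/-- **Off the additive fibre `X₁(9)` is multiplicative at `3`, of type `I₉ₑ`.**  Let `E/ℚ` be elliptic,
`C • W = E₉(f)` with `3 ∤ num(f) + den(f)`.  Then at `v ∣ 3` the Kodaira symbol is `Iₙ` with
`n = 9·(v₃(num f) + v₃(num f - den f) + v₃(den f)) ≥ 9` (the numerator forms of `c₄`, `c₆` are
`3`-adic units and `Δ = num⁹(num - den)⁹·unit/den²⁷`).  In particular a curve over `ℚ` with a rational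
point of order `9` never has good reduction at `3`.
[cite: BarriosRoy2022LocalData, Thm. 3.8 (table, T = C₉: additive at 3 iff 3 ∣ a + b)]
[cite: Rizzo2003, Table II (p. 4), row (0,0,≥1)] -/
theorem kodairaSymbolAt_eq_I_of_smul_eq_kubertTate_nine [W.IsElliptic]
    (hC : C • W = kubertTate (f ^ 2 * (f - 1) * (f ^ 2 - f + 1)) (f ^ 2 * (f - 1)))
    (h3 : ¬ (3 : ℤ) ∣ f.num + f.den) {v : HeightOneSpectrum ℤ} (hv : ringChar (ℤ ⧸ v.asIdeal) = 3) :
    W.kodairaSymbolAt v =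
        KodairaSymbol.I (9 * (padicValInt 3 f.num + padicValInt 3 (f.num - f.den) + padicValNat 3 f.den)) ∧
      1 ≤ padicValInt 3 f.num + padicValInt 3 (f.num - f.den) + padicValNat 3 f.den := by
  obtain ⟨hO, hE1⟩ := ofInvariants_eq_row_0_0_of_smul_eq_kubertTate_nine hC h3
  refine ⟨?_, hE1⟩
  have hrow := kodaira_row_0_0_pos
    (c := ((9 * (padicValInt 3 f.num + padicValInt 3 (f.num - f.den) + padicValNat 3 f.den) : ℕ) : ℤ))
    (by exact_mod_cast (by omega : 1 ≤ 9 * (padicValInt 3 f.num + padicValInt 3 (f.num - f.den) +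
      padicValNat 3 f.den))) (res9 W.c₄) (res9 W.c₆) (res9 W.Δ)
  rw [Int.toNat_natCast] at hrow
  rw [kodairaSymbolAt_eq_tableKodairaSymbolThree W hv, tableKodairaSymbolThree_def]
  unfold kodairaOfInvariants
  rw [hO]
  exact hrow

/-- **… with conductor exponent `f₃ = 1`** off the additive fibre (multiplicative reduction).
[cite: BarriosRoy2022LocalData, Thm. 3.8 (table, T = C₉)] [cite: Rizzo2003, Table II (p. 4), row (0,0,≥1)] -/
theorem conductorExponent_eq_one_of_smul_eq_kubertTate_nine [W.IsElliptic]
    (hC : C • W = kubertTate (f ^ 2 * (f - 1) * (f ^ 2 - f + 1)) (f ^ 2 * (f - 1)))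
    (h3 : ¬ (3 : ℤ) ∣ f.num + f.den) {v : HeightOneSpectrum ℤ} (hv : ringChar (ℤ ⧸ v.asIdeal) = 3) :
    W.conductorExponent v = 1 := by
  obtain ⟨hO, hE1⟩ := ofInvariants_eq_row_0_0_of_smul_eq_kubertTate_nine hC h3
  have hrow := condExp_row_0_0_pos
    (c := ((9 * (padicValInt 3 f.num + padicValInt 3 (f.num - f.den) + padicValNat 3 f.den) : ℕ) : ℤ))
    (by exact_mod_cast (by omega : 1 ≤ 9 * (padicValInt 3 f.num + padicValInt 3 (f.num - f.den) +
      padicValNat 3 f.den))) (res9 W.c₄) (res9 W.c₆) (res9 W.Δ)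
  rw [conductorExponent_eq_tableConductorExponentThree_holds W v hv, tableConductorExponentThree_def]
  unfold condExpOfInvariants
  rw [hO]
  exact hrow

end LocalData

end WeierstrassCurve

end
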